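import Mathlib
import Summits.RiemannHypothesis.RiemannHypothesis.Theorems.HandoffRealZeroCount
import Summits.RiemannHypothesis.RiemannHypothesis.Theorems.HandoffXiZeroCount
import Literature.NumberTheory.LFunctions.RiemannXiProofs
import Literature.NumberTheory.LFunctions.ZetaZeros
import Literature.NumberTheory.LFunctions.RHWave0
import Literature.Analysis.Complex.FourierPolyaKiKimEngine
import HarnessLib

/-!
# ROUTE R-K «COUNT-AND-THIN»: in an RH-world with simple zeros, THIN gives COUNT (off the ordinates)

Handoff track (ROUTE 1′), prove-1 gen13; companion of `HandoffCountThin.lean` (idea-3 gen22 ROUTE R-K;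
HOME/handoff/IDEAS-finite-rank.md v3.3.1 §G22-3 remark (3): «RH-WORLD: under RH + simple zeros,
SC-3 ⟹ SC-2 … so in the RH world the pair collapses to SC-3»). Built imports only.

* `eventually_sign_change_of_hasDerivAt`, `eventually_exists_zero_of_sign_change` — a simple zero
  of a differentiable real function is a strict sign change, and sign changes survive uniform
  convergence (intermediate value theorem).
* ★ `count_of_nhds_of_riemannHypothesis` — THE CONVERSE IN THE RH-WORLD, open-neighbourhood form: if
  `RiemannHypothesis` and `SimpleZerosConjecture` hold, then for any family of entire, real-on-`ℝ`
  functions `û_t` with real normalisers `c_t ≠ 0` such that `c_t û_t → Ξ` locally uniformly on an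
  open `U ⊇ [0, T]`, and any `T` that is NOT the ordinate of a zero, eventually
  `#{x ∈ (0, T] : û_t(x) = 0} = N(T)` (SC-2 at `T`). Lower count: sign changes at the `N(T)` simple
  real zeros of `Ξ`; upper count: `RealZeroCount.eventually_ncard_zeros_le` with all orders `1`.
  The restriction «`T` not an ordinate» is NECESSARY: `û_t(z) := Ξ((1 - 1/(t+2)) z)` converges to `Ξ`
  locally uniformly and has `N(γ) - m(γ)` zeros in `(0, γ]` at every ordinate `γ` (remark).

With `HandoffCountThinNhds.im_eq_zero_of_count_of_nhds` (COUNT at `T` ⟹ RH up to `T`): GIVEN the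
near-axis convergence, COUNT off the ordinates is RH up to simplicity. Nothing here is, or
suggests, a proof of RH.
-/

set_option linter.dupNamespace false  -- the mandated namespace repeats `RiemannHypothesis`

noncomputable section

open Filter Set Topology Metric Complex
open scoped BigOperators
open Literature.NumberTheory.LFunctions Literature.Analysis.Complex.KiKim

namespace Summit.RiemannHypothesis.RiemannHypothesis.Theorems

namespace CountThin

open RealZeroCount

/-! ## Sign changes survive uniform convergence -/

/-- A simple zero of a differentiable real function is a strict sign change: if `f c = 0` and
`f' (c) ≠ 0` then for all small `η > 0`, `f (c - η)` and `f (c + η)` are non-zero of opposite signs. -/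
theorem eventually_sign_change_of_hasDerivAt {f : ℝ → ℝ} {c d : ℝ} (hf : HasDerivAt f d c)
    (hc : f c = 0) (hd : d ≠ 0) :
    ∀ᶠ η : ℝ in 𝓝[>] 0, f (c - η) * f (c + η) < 0 := by
  -- the slope `(f (c + h) - f c) / h → d`, so it has the sign of `d` for small `h ≠ 0`
  have hslope : Tendsto (fun h : ℝ => h⁻¹ * (f (c + h) - f c)) (𝓝[≠] 0) (𝓝 d) := by
    have := hf.tendsto_slope_zero
    simpa [smul_eq_mul] using this
  have hpos : ∀ᶠ h : ℝ in 𝓝[≠] 0, 0 < d * (h⁻¹ * (f (c + h) - f c)) := by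
    have : Tendsto (fun h : ℝ => d * (h⁻¹ * (f (c + h) - f c))) (𝓝[≠] 0) (𝓝 (d * d)) :=
      hslope.const_mul d
    exact this.eventually (eventually_gt_nhds (mul_self_pos.mpr hd))
  -- pass to `η > 0` and `-η < 0`
  have h1 : ∀ᶠ η : ℝ in 𝓝[>] 0, 0 < d * (η⁻¹ * (f (c + η) - f c)) :=
    hpos.filter_mono (nhdsWithin_mono _ fun x hx => ne_of_gt hx)
  have h2 : ∀ᶠ η : ℝ in 𝓝[>] 0, 0 < d * ((-η)⁻¹ * (f (c + -η) - f c)) := by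
    have hneg : Tendsto (fun η : ℝ => -η) (𝓝[>] (0 : ℝ)) (𝓝[≠] 0) := by
      refine tendsto_nhdsWithin_of_tendsto_nhds_of_eventually_within _ ?_ ?_
      · simpa using (continuous_neg.tendsto (0 : ℝ)).mono_left nhdsWithin_le_nhds
      · filter_upwards [self_mem_nhdsWithin] with η hη
        exact neg_ne_zero.mpr (ne_of_gt hη)
    exact hneg.eventually hpos
  filter_upwards [h1, h2, self_mem_nhdsWithin] with η hη1 hη2 hη
  rw [hc, sub_zero] at hη1 hη2
  rw [sub_eq_add_neg]
  -- `d * f(c+η) / η > 0` and `-d * f(c-η) / η > 0`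
  have hη0 : (0 : ℝ) < η := hη
  have e1 : 0 < d * f (c + η) := by
    have h' : d * f (c + η) = (d * (η⁻¹ * f (c + η))) * η := by
      field_simp
    rw [h']; exact mul_pos hη1 hη0
  have e2 : d * f (c + -η) < 0 := by
    have h' : d * f (c + -η) = -((d * ((-η)⁻¹ * f (c + -η))) * η) := by
      field_simp
    rw [h']; exact neg_neg_of_pos (mul_pos hη2 hη0)
  -- `d·f(c+η) > 0 > d·f(c-η)` forces `f(c-η)·f(c+η) < 0`
  have : (d * f (c + -η)) * (d * f (c + η)) < 0 := mul_neg_of_neg_of_pos e2 e1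
  nlinarith [sq_nonneg d, mul_self_pos.mpr hd, this]

/-- Sign changes survive uniform convergence: if `f (c - η) * f (c + η) < 0`, `f` and the `G n`
are continuous, and `G n → f` uniformly on a set containing `[c - η, c + η]`, then eventually each
`G n` has a zero in `(c - η, c + η)`. (Intermediate value theorem.) -/
theorem eventually_exists_zero_of_sign_change {ι : Type*} {l : Filter ι} {f : ℝ → ℝ}
    {G : ι → ℝ → ℝ} {s : Set ℝ} {c η : ℝ} (hη : 0 < η) (hsub : Icc (c - η) (c + η) ⊆ s)
    (hsign : f (c - η) * f (c + η) < 0) (hG : ∀ᶠ n in l, Continuous (G n))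
    (hconv : TendstoUniformlyOn G f l s) :
    ∀ᶠ n in l, ∃ x ∈ Ioo (c - η) (c + η), G n x = 0 := by
  set m := min |f (c - η)| |f (c + η)| with hm
  have hne1 : f (c - η) ≠ 0 := fun h => by rw [h, zero_mul] at hsign; exact lt_irrefl _ hsign
  have hne2 : f (c + η) ≠ 0 := fun h => by rw [h, mul_zero] at hsign; exact lt_irrefl _ hsign
  have hm0 : 0 < m := lt_min (abs_pos.mpr hne1) (abs_pos.mpr hne2)
  have hclose : ∀ᶠ n in l, ∀ x ∈ s, |G n x - f x| < m := by
    have := (Metric.tendstoUniformlyOn_iff.mp hconv) m hm0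
    filter_upwards [this] with n hn x hx
    rw [← Real.dist_eq, dist_comm]; exact hn x hx
  filter_upwards [hclose, hG] with n hn hGc
  have ha := hn (c - η) (hsub ⟨le_rfl, by linarith⟩)
  have hb := hn (c + η) (hsub ⟨by linarith, le_rfl⟩)
  have hlt : c - η < c + η := by linarith
  -- the endpoint values of `G n` have the signs of those of `f`
  rcases lt_or_gt_of_ne hne1 with h1 | h1
  · have h2 : 0 < f (c + η) := by
      by_contra h; push Not at h
      have := mul_nonneg_of_nonpos_of_nonpos h1.le h
      linarith
    have hGa : G n (c - η) < 0 := by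
      have : |f (c - η)| = -f (c - η) := abs_of_neg h1
      have hm1 : m ≤ |f (c - η)| := min_le_left _ _
      rw [abs_lt] at ha; linarith
    have hGb : 0 < G n (c + η) := by
      have : |f (c + η)| = f (c + η) := abs_of_pos h2
      have hm2 : m ≤ |f (c + η)| := min_le_right _ _
      rw [abs_lt] at hb; linarith
    obtain ⟨x, hx, hx0⟩ := intermediate_value_Ioo hlt.le hGc.continuousOn ⟨hGa, hGb⟩
    exact ⟨x, hx, hx0⟩
  · have h2 : f (c + η) < 0 := by
      by_contra h; push Not at h
      have := mul_nonneg h1.le h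
      linarith
    have hGa : 0 < G n (c - η) := by
      have : |f (c - η)| = f (c - η) := abs_of_pos h1
      have hm1 : m ≤ |f (c - η)| := min_le_left _ _
      rw [abs_lt] at ha; linarith
    have hGb : G n (c + η) < 0 := by
      have : |f (c + η)| = -f (c + η) := abs_of_neg h2
      have hm2 : m ≤ |f (c + η)| := min_le_right _ _
      rw [abs_lt] at hb; linarith
    obtain ⟨x, hx, hx0⟩ := intermediate_value_Ioo' hlt.le hGc.continuousOn ⟨hGb, hGa⟩
    exact ⟨x, hx, hx0⟩

/-! ## The RH-world converse: near-axis convergence + RH ∧ simple zeros give the count law -/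

/-- **COUNT FROM THIN IN THE RH-WORLD** (idea-3 §G22-3 remark (3), made precise; open-neighbourhood
form). Assume `RiemannHypothesis` and `SimpleZerosConjecture`. Let `û_t = F t` be entire and real on
`ℝ`, `c_t ≠ 0` real with `c_t û_t → Ξ` locally uniformly on an open `U ⊇ [0, T]`, `T` not the
ordinate of a zero (`∀ z, Ξ z = 0 → Re z ≠ T`). Then eventually `#{x ∈ (0, T] : û_t(x) = 0} = N(T)`. -/
theorem count_of_nhds_of_riemannHypothesis (hRH : RiemannHypothesis) (hS : SimpleZerosConjecture)
    {F : ℝ → ℂ → ℂ} (hdiff : ∀ t, Differentiable ℂ (F t))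
    (hreal : ∀ (t : ℝ) (x : ℝ), (F t x).im = 0) {c : ℝ → ℝ} (hc : ∀ t, c t ≠ 0)
    {T : ℝ} (hTord : ∀ z : ℂ, riemannXiUpper z = 0 → z.re ≠ T)
    {U : Set ℂ} (hUo : IsOpen U) (hseg : ∀ x ∈ Icc (0 : ℝ) T, (x : ℂ) ∈ U)
    (hloc : TendstoLocallyUniformlyOn (fun t z => ((c t : ℝ) : ℂ) * F t z) riemannXiUpper atTop U) :
    ∀ᶠ t : ℝ in atTop,
      {x : ℝ | 0 < x ∧ x ≤ T ∧ F t x = 0}.encard = (zetaZeroCount T : ℕ∞) := by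
  classical
  set Φ : ℝ → ℂ → ℂ := fun t z => ((c t : ℝ) : ℂ) * F t z with hΦ
  have hΦd : ∀ t, Differentiable ℂ (Φ t) := fun t => (differentiable_const _).mul (hdiff t)
  -- two RH-world facts about the zeros of `Ξ`: real (RH) and of analytic order one (simplicity)
  have xi_real : ∀ {z : ℂ}, riemannXiUpper z = 0 → z.im = 0 := fun {z} hz =>
    ((riemannHypothesis_iff_im_eq_zero_of_riemannXiUpper_eq_zero_holds : RiemannHypothesis ↔ _).mp
      hRH) z hz
  have xi_simple : ∀ {z : ℂ}, riemannXiUpper z = 0 → analyticOrderNatAt riemannXiUpper z = 1 := by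
    intro z hz
    obtain ⟨hζ, h0, h1⟩ := zeta_zero_of_riemannXiUpper_eq_zero hz
    set ρ := 1 / 2 + I * z with hρ
    have hρ1 : ρ ≠ 1 := fun h => by rw [h] at h1; simp at h1
    have hder : deriv riemannZeta ρ ≠ 0 :=
      hS ρ (mem_riemannZetaNontrivialZeros_of_riemannXi_eq_zero hz)
    have hord : analyticOrderAt riemannZeta ρ = 1 :=
      (analyticOn_riemannZeta ρ hρ1).analyticOrderAt_eq_one_of_zero_deriv_ne_zero hζ hder
    have hm : riemannZetaZeroOrder ρ = 1 := by
      rw [riemannZetaZeroOrder, (analyticOn_riemannZeta ρ hρ1).meromorphicOrderAt_eq, hord]; simp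
    have := analyticOrderNatAt_riemannXiUpper_eq h0 h1
    rw [hm] at this
    exact_mod_cast this
  set g : ℝ → ℝ := fun x => (riemannXiUpper x).re with hg
  set G : ℝ → ℝ → ℝ := fun t x => (Φ t x).re with hG
  set B := (xiZeros_finite T).toFinset with hB
  set Z : Finset ℝ := B.image Complex.re with hZ
  set k : ℝ → ℕ := fun c => analyticOrderNatAt riemannXiUpper (c : ℂ) with hk
  have hΞreal := im_riemannXiUpper_ofReal_holds
  have hΞd := differentiable_riemannXiUpper'
  -- in the RH-world every zero in the box is real and simple
  have hBreal : ∀ z ∈ B, z.im = 0 := fun z hz => xi_real ((Set.Finite.mem_toFinset _).mp hz).1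
  have hBre : ∀ z ∈ B, ((z.re : ℝ) : ℂ) = z := fun z hz =>
    Complex.ext (by simp) (by simp [hBreal z hz])
  have hZmem : ∀ c ∈ Z, riemannXiUpper c = 0 ∧ 0 < c ∧ c < T := by
    intro c hc
    obtain ⟨z, hz, rfl⟩ := Finset.mem_image.mp hc
    obtain ⟨hz0, hzpos, hzT⟩ := (Set.Finite.mem_toFinset _).mp hz
    refine ⟨by rw [hBre z hz]; exact hz0, hzpos, lt_of_le_of_ne hzT (hTord z hz0)⟩
  have hcardZ : Z.card = zetaZeroCount T := by
    rw [hZ, Finset.card_image_of_injOn fun z hz w hw h => Complex.ext h (by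
      rw [hBreal z (by simpa using hz), hBreal w (by simpa using hw)]),
      ← sum_analyticOrderNatAt_eq_zetaZeroCount T, ← hB, Finset.card_eq_sum_ones]
    exact Finset.sum_congr rfl fun z hz => (xi_simple ((Set.Finite.mem_toFinset _).mp hz).1).symm
  have hsumZ : ∑ c ∈ Z, k c = zetaZeroCount T := by
    rw [← hcardZ, Finset.card_eq_sum_ones]
    refine Finset.sum_congr rfl fun c hc => ?_
    exact xi_simple (hZmem c hc).1
  -- UPPER COUNT (Rolle)
  have hgzero : ∀ x ∈ Icc (0 : ℝ) T, g x = 0 → x ∈ Z := by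
    intro x hx hgx
    have hΞx : riemannXiUpper x = 0 := Complex.ext (by simpa [g] using hgx) (by simpa using hΞreal x)
    have hx0 : 0 < x := by
      rcases hx.1.eq_or_lt with h | h
      · exact absurd (show (x : ℂ).re = 0 by simp [← h]) (re_ne_zero_of_riemannXiUpper_eq_zero hΞx)
      · exact h
    refine Finset.mem_image.mpr ⟨(x : ℂ), ?_, by simp⟩
    exact (Set.Finite.mem_toFinset _).mpr ⟨hΞx, by simpa using hx0, by simpa using hx.2⟩
  have hG0 : TendstoUniformlyOn G g atTop (Icc 0 T) := by
    have := tendstoUniformlyOn_re_iteratedDeriv hUo hΦd hloc hseg 0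
    simp only [iteratedDeriv_zero] at this
    exact this
  have hupper : ∀ᶠ t : ℝ in atTop, {x | x ∈ Icc (0 : ℝ) T ∧ G t x = 0}.Finite ∧
      {x | x ∈ Icc (0 : ℝ) T ∧ G t x = 0}.ncard ≤ ∑ c ∈ Z, k c := by
    refine eventually_ncard_zeros_le (N := Z.sup k)
      (contDiff_re_ofReal (n := 0) hΞd).continuous
      hgzero ?_ ?_ (fun c hc => Finset.le_sup hc) (Eventually.of_forall fun t => contDiff_re_ofReal (hΦd t))
      hG0 ?_
    · intro c _
      exact ((contDiff_re_ofReal (n := ⊤) hΞd).continuous_iteratedDeriv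
        (k c) (by exact_mod_cast le_top)).continuousAt
    · intro c _
      rw [iteratedDeriv_re_ofReal hΞd]
      have him := im_iteratedDeriv_ofReal_eq_zero hΞd hΞreal (k c) c
      exact fun h => iteratedDeriv_analyticOrderNatAt_ne_zero (c : ℂ)
        (Complex.ext (by simpa using h) (by simpa using him))
    · intro c _
      have := tendstoUniformlyOn_re_iteratedDeriv hUo hΦd hloc hseg (k c)
      rw [iteratedDeriv_re_ofReal hΞd]
      refine this.congr (Eventually.of_forall fun t => ?_)
      intro x _
      change (iteratedDeriv (k c) (Φ t) x).re = iteratedDeriv (k c) (fun y : ℝ => (Φ t y).re) x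
      rw [iteratedDeriv_re_ofReal (hΦd t)]
  -- LOWER COUNT (sign changes): a common half-width `η` for all zeros
  have hder : ∀ c ∈ Z, HasDerivAt g (deriv riemannXiUpper c).re c ∧ (deriv riemannXiUpper c).re ≠ 0 := by
    intro c hc
    refine ⟨hasDerivAt_re_ofReal (hΞd.differentiableAt), ?_⟩
    have h1 : analyticOrderNatAt riemannXiUpper c = 1 := xi_simple (hZmem c hc).1
    have hne := iteratedDeriv_analyticOrderNatAt_ne_zero (c : ℂ)
    rw [h1, iteratedDeriv_one] at hne
    have him : (deriv riemannXiUpper c).im = 0 := by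
      simpa [iteratedDeriv_one] using im_iteratedDeriv_ofReal_eq_zero hΞd hΞreal 1 c
    exact fun h => hne (Complex.ext (by simpa using h) (by simpa using him))
  have hη : ∃ η : ℝ, 0 < η ∧ (∀ c ∈ Z, g (c - η) * g (c + η) < 0) ∧ (∀ c ∈ Z, η < c ∧ c + η < T) ∧
      ∀ c ∈ Z, ∀ c' ∈ Z, c ≠ c' → 2 * η < |c - c'| := by
    have e1 : ∀ᶠ η : ℝ in 𝓝[>] 0, ∀ c ∈ Z, g (c - η) * g (c + η) < 0 :=
      (Z.eventually_all).mpr fun c hc =>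
        eventually_sign_change_of_hasDerivAt (hder c hc).1 (by
          have := (hZmem c hc).1
          simp [g, this]) (hder c hc).2
    have e2 : ∀ᶠ η : ℝ in 𝓝[>] 0, ∀ c ∈ Z, η < c ∧ c + η < T :=
      (Z.eventually_all).mpr fun c hc => by
        have h1 : ∀ᶠ η : ℝ in 𝓝 0, η < c := eventually_lt_nhds (hZmem c hc).2.1
        have h2 : ∀ᶠ η : ℝ in 𝓝 0, η < T - c := eventually_lt_nhds (by linarith [(hZmem c hc).2.2])
        filter_upwards [nhdsWithin_le_nhds h1, nhdsWithin_le_nhds h2] with η a b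
        exact ⟨a, by linarith⟩
    have e3 : ∀ᶠ η : ℝ in 𝓝[>] 0, ∀ c ∈ Z, ∀ c' ∈ Z, c ≠ c' → 2 * η < |c - c'| :=
      (Z.eventually_all).mpr fun c _ => (Z.eventually_all).mpr fun c' _ => by
        by_cases hcc : c = c'
        · exact Eventually.of_forall fun _ h => absurd hcc h
        · have hev : ∀ᶠ η : ℝ in 𝓝 0, 2 * η < |c - c'| := by
            have hpos : 0 < |c - c'| := abs_pos.mpr (sub_ne_zero.mpr hcc)
            have hcont : Tendsto (fun η : ℝ => 2 * η) (𝓝 0) (𝓝 (2 * 0)) :=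
              (continuous_const.mul continuous_id).tendsto (0 : ℝ)
            rw [mul_zero] at hcont
            exact hcont.eventually (eventually_lt_nhds hpos)
          have hev' : ∀ᶠ η : ℝ in 𝓝[>] 0, 2 * η < |c - c'| := nhdsWithin_le_nhds hev
          exact hev'.mono fun _ h _ => h
    obtain ⟨η, ⟨h1, h2, h3⟩, hη0⟩ :=
      ((e1.and (e2.and e3)).and self_mem_nhdsWithin).exists
    exact ⟨η, hη0, h1, h2, h3⟩
  obtain ⟨η, hη0, hsign, hloc', hsep⟩ := hη
  have hlower : ∀ᶠ t : ℝ in atTop, ∀ c ∈ Z, ∃ x ∈ Ioo (c - η) (c + η), G t x = 0 := by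
    refine (Z.eventually_all).mpr fun c hc => ?_
    refine eventually_exists_zero_of_sign_change hη0 ?_ (hsign c hc)
      (Eventually.of_forall fun t => (contDiff_re_ofReal (n := 0) (hΦd t)).continuous) hG0
    intro x hx
    exact ⟨by linarith [hx.1, (hloc' c hc).1], by linarith [hx.2, (hloc' c hc).2]⟩
  -- COMBINE
  filter_upwards [hupper, hlower] with t ⟨hfin, hle⟩ hlow
  choose! x hxI hx0 using hlow
  set A : Set ℝ := {x : ℝ | 0 < x ∧ x ≤ T ∧ F t x = 0} with hA
  have hGF : ∀ y : ℝ, G t y = 0 → F t y = 0 := by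
    intro y hy
    have h1 : (Φ t y).re = 0 := hy
    have h2 : c t * (F t y).re = 0 := by
      have : (Φ t y).re = c t * (F t y).re := by
        show ((((c t : ℝ) : ℂ)) * F t y).re = _
        rw [Complex.re_ofReal_mul]
      rw [← this]; exact h1
    have h3 : (F t y).re = 0 := by
      rcases mul_eq_zero.mp h2 with h | h
      · exact absurd h (hc t)
      · exact h
    exact Complex.ext (by simpa using h3) (by simpa using hreal t y)
  have hsub : A ⊆ {x | x ∈ Icc (0 : ℝ) T ∧ G t x = 0} := by
    rintro y ⟨hy0, hyT, hFy⟩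
    exact ⟨⟨hy0.le, hyT⟩, by simp [G, Φ, hFy]⟩
  have hup : A.encard ≤ (zetaZeroCount T : ℕ∞) := by
    have hle' : {x | x ∈ Icc (0 : ℝ) T ∧ G t x = 0}.ncard ≤ zetaZeroCount T := hsumZ ▸ hle
    refine (Set.encard_le_encard hsub).trans ?_
    rw [← hfin.cast_ncard_eq]
    exact_mod_cast hle'
  have hinj : Set.InjOn x (Z : Set ℝ) := by
    intro c hc c' hc' hxx
    by_contra hne
    have h1 := hxI c hc
    have h2 := hxI c' hc'
    rw [hxx] at h1
    have : |c - c'| < 2 * η := by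
      rw [abs_lt]; constructor <;> linarith [h1.1, h1.2, h2.1, h2.2]
    linarith [hsep c hc c' hc' hne]
  have himage : x '' (Z : Set ℝ) ⊆ A := by
    rintro _ ⟨c, hc, rfl⟩
    have hc' : c ∈ Z := hc
    exact ⟨by linarith [(hxI c hc').1, (hloc' c hc').1], by linarith [(hxI c hc').2, (hloc' c hc').2],
      hGF _ (hx0 c hc')⟩
  have hlow : (zetaZeroCount T : ℕ∞) ≤ A.encard := by
    rw [← hcardZ, ← Set.encard_coe_eq_coe_finsetCard, ← hinj.encard_image]
    exact Set.encard_le_encard himage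
  exact le_antisymm hup hlow

/-! Axiom census (expected `propext`, `Classical.choice`, `Quot.sound`). -/
#print axioms count_of_nhds_of_riemannHypothesis

end CountThin

end Summit.RiemannHypothesis.RiemannHypothesis.Theorems

end
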